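import Summits.KontsevichZagierPeriods.KontsevichZagierPeriods.Theses.HurwitzMicroSectors
import Summits.KontsevichZagierPeriods.KontsevichZagierPeriods.Theorems.HurwitzMicroSectorsNormalFormPrinciplePiBoxTransfer

/-! TTRL-lite variant V2202 of stmt-KontsevichZagierPeriods-3869

Variant V2202 = `stub_boxRigidity` (the leaf `BoxRigidity` of `NormalFormPrinciple`: two
BOX-RATIONAL representations — domain the open unit box, integrand `p/q` over `ℚ` — with equal values
are KZ-equivalent) under the move `drop_hyp:0`: the hypothesis `N.domain = (0,1)ᵐ` on the LEFT
representation is dropped, so `N` is any representation of KZ's rational shape on any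
`ℚ`-semialgebraic domain, while `N'` stays box-rational. Verdict of the attempt seat: **open — and
EXACTLY the Summit**. (The bare equivalence `V2202 ↔ KontsevichZagierPeriods` is already in the tree as
`stub_boxRigidity_dropLeft_iff_statement`, file `…Variants2214` — the mirrored move `drop_hyp:2`
transported by symmetry of `Equivalent` — and is deliberately not restated here.) This file is the
certificate for V2202 proper, by the DIRECT left-side mechanism, packaged against the crux, the kernel
form and the parent leaf:

* `vanishing_of_stub_boxRigidity_var2202`: since the free side `N` may be any rational-shape
  representation, every representation `R` of value `0` — rational or not, on any domain — is a
  relation: `R ∼ R'` of rational shape (`KZ.exists_isRational_equivalent_holds`, KZ §1.1 remark: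
  algebraic integrands reduce to rational ones), `R'.value = 0` by soundness, and V2202 compares `R'`
  with the zero representation on the `0`-box (box-rational, value `0`, itself a relation);
* `kzKernelConjecture_of_vanishing_var2202`: vanishing of single representations is the kernel
  conjecture — a formal combination is `≡ [r] − [r'] ≡ [r] + [r'.neg] ≡ [R]` for ONE representation `R`
  (`KZ.exists_integralRep_sub_holds`, the merging lemma `KZ.IntegralRep.exists_of_add_of_sub_of_mem_relations`:
  slabs at disjoint levels glued by rule 1a)), of value `0` by soundness; with
  `vanishing_iff_statement_var2202` (vanishing of ALL value-`0` representations ⟺ the Summit);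
* hence `statement_of_stub_boxRigidity_var2202` / `stub_boxRigidity_var2202_of_statement` (V2202 ⇒
  Summit ⇒ V2202), and the variant against the CRUX by name,
  `stub_boxRigidity_var2202_iff_normalFormPrinciple : V2202 ↔ NormalFormPrinciple`
  (stmt-KontsevichZagierPeriods-3869 itself), against the kernel form
  (`stub_boxRigidity_var2202_iff_kzKernelConjecture`), and against its PARENT:
  `stub_boxRigidity_var2202_iff_parent_and_piCancellation : V2202 ↔ BoxRigidity ∧ KZ.PiCancellation`
  (`statement_iff_leaves`) — what `drop_hyp:0` silently adds to the leaf is precisely the line's other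
  leaf, `π`-cancellation (item stmt-KontsevichZagierPeriods-0540): the domain hypothesis on one side is
  the whole geometric content that `PiBoxReduction` removes only up to a power of `[π]`;
  `piLocalKernel_of_stub_boxRigidity_var2202` (⇒ Ayoub's localised kernel conjecture, open).
So V2202 can be neither proved (a proof proves the Summit, the Kontsevich–Zagier period conjecture for
the calculus of `KZCalculus.lean`) nor refuted (a refutation refutes it) from the tree; residual goal =
the Summit. Source: M. Kontsevich, D. Zagier, *Periods* (2001), §1.1 (remark after the Definition),
§1.2 Conjecture 1. Pure proof file, no definitions. -/

-- `Summit.<Summit>.<Problem>` is the tree's mandated summit-side namespace (CONVENTIONS §2); for this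
-- single-conjunct summit the two coincide, so the duplicate is deliberate.
set_option linter.dupNamespace false

noncomputable section

namespace Summit.KontsevichZagierPeriods.KontsevichZagierPeriods.Theorems

open MeasureTheory Set
open Literature.NumberTheory.Transcendental Literature.NumberTheory.Transcendental.KZ
open Summit.KontsevichZagierPeriods.KontsevichZagierPeriods.Theses.HurwitzMicroSectors
open Summit.KontsevichZagierPeriods.HurwitzMicroSectors.NormalFormPrinciple.PiBox

/-! ## Single-representation vanishing is the kernel conjecture -/

/-- **Vanishing ⇒ `ker eval = relations`.** If every integral representation of value `0` is a
relation, then every formal combination `c` with `eval c = 0` is a relation: `c ≡ [r] − [r']`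
(`KZ.exists_integralRep_sub_holds`), `−[r'] ≡ [r'.neg]` (rule 1b)), `[r] + [r'.neg] ≡ [R]` for one
representation `R` (`KZ.IntegralRep.exists_of_add_of_sub_of_mem_relations`: slabs in a common dimension
at disjoint levels, glued by rule 1a)), and `R.value = eval c = 0` by soundness.
[cite: KontsevichZagier2001, §1.2 Conjecture 1] -/
theorem kzKernelConjecture_of_vanishing_var2202
    (hvan : ∀ (n : ℕ) (R : IntegralRep n), R.value = 0 → of R ∈ relations) :
    KZKernelConjecture := by
  intro c hc
  obtain ⟨n, m, r, r', hrel⟩ := exists_integralRep_sub_holds c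
  obtain ⟨N, R, hR⟩ := r.exists_of_add_of_sub_of_mem_relations r'.neg
  have hneg : of r' + of r'.neg ∈ relations :=
    of_add_of_mem_relations_of_eqOn_neg rfl fun x _ => rfl
  have hRv : R.value = 0 := by
    have e1 := relations_le_ker_eval_holds hrel
    have e2 := relations_le_ker_eval_holds hR
    simp only [AddMonoidHom.mem_ker, map_sub, map_add, eval_of, IntegralRep.value_neg, hc] at e1 e2
    linarith
  have e : c = (c - (of r - of r')) + (of r + of r'.neg - of R) - (of r' + of r'.neg) + of R := by
    abel
  rw [e]
  exact relations.add_mem (relations.sub_mem (relations.add_mem hrel hR) hneg) (hvan N R hRv)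

/-- **Vanishing of every value-`0` representation ⟺ the Summit.** (⇒) `kzKernelConjecture_of_vanishing_var2202`
and `kzKernelConjecture_iff_isRational`; (⇐) the Summit is the kernel form, applied to `c = [R]`.
[cite: KontsevichZagier2001, §1.2 Conjecture 1] -/
theorem vanishing_iff_statement_var2202 :
    (∀ (n : ℕ) (R : IntegralRep n), R.value = 0 → of R ∈ relations) ↔ _root_.KontsevichZagierPeriods :=
  ⟨fun hvan => _root_.KontsevichZagierPeriods_iff.2 (kzKernelConjecture_iff_isRational.1
      (kzKernelConjecture_of_vanishing_var2202 hvan)),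
    fun h _ R hv => (kzKernelConjecture_iff_isRational.2 (_root_.KontsevichZagierPeriods_iff.1 h))
      (of R) (by rw [eval_of, hv])⟩

/-! ## The variant V2202: rational shape on any domain versus box-rational -/

/-- **V2202 ⇒ vanishing for ALL representations.** A representation `R` of value `0` is
KZ-equivalent to one of KZ's rational shape `R'` (`KZ.exists_isRational_equivalent_holds`), of value
`0` by soundness; the zero representation `Z` on the box `(0,1)⁰` is box-rational of value `0` and a
relation; V2202 (no domain hypothesis on the left) gives `[R] ≡ [R'] ≡ [Z] ≡ 0`.
[cite: KontsevichZagier2001, §1.1 remark after the Definition] -/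
theorem vanishing_of_stub_boxRigidity_var2202
    (h : ∀ (m m' : ℕ) (N : IntegralRep m) (N' : IntegralRep m'), N.IsRational → N'.domain = {x | ∀ i, x i ∈ Set.Ioo (0:ℝ) 1} → N'.IsRational → N.value = N'.value → Equivalent N N')
    (n : ℕ) (R : IntegralRep n) (hv : R.value = 0) : of R ∈ relations := by
  obtain ⟨m, R', hR'r, hRR'⟩ := exists_isRational_equivalent_holds R
  obtain ⟨Z, hZd, hZi⟩ := exists_zeroRep (isSemialgebraic_box 0)
  have hZ : of Z ∈ relations := of_mem_relations_of_eqOn_zero Z (by simp [hZi, EqOn])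
  have hZv : Z.value = 0 := by simp [IntegralRep.value, hZi]
  have hZr : Z.IsRational := ⟨0, 1, fun x _ => by simp, fun x _ => by simp [hZi]⟩
  have hR'v : R'.value = 0 := (Equivalent.value_eq_holds hRR').symm.trans hv
  have hE : of R' - of Z ∈ relations := h m 0 R' Z hR'r hZd hZr (by rw [hR'v, hZv])
  have h1 : of R' ∈ relations := by
    have := relations.add_mem hE hZ
    rwa [sub_add_cancel] at this
  have h0 : of R - of R' ∈ relations := hRR'
  have := relations.add_mem h0 h1
  rwa [sub_add_cancel] at this

/-- **V2202 ⇒ `KontsevichZagierPeriods`**: the variant proves the Summit (vanishing of all value-`0`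
representations, `vanishing_iff_statement_var2202`). [cite: KontsevichZagier2001, §1.2 Conjecture 1] -/
theorem statement_of_stub_boxRigidity_var2202
    (h : ∀ (m m' : ℕ) (N : IntegralRep m) (N' : IntegralRep m'), N.IsRational → N'.domain = {x | ∀ i, x i ∈ Set.Ioo (0:ℝ) 1} → N'.IsRational → N.value = N'.value → Equivalent N N') :
    _root_.KontsevichZagierPeriods :=
  vanishing_iff_statement_var2202.1 (vanishing_of_stub_boxRigidity_var2202 h)

/-- **`KontsevichZagierPeriods` ⇒ V2202**: the variant is a special case of Conjecture 1 for the
tree's calculus (both representations have KZ's rational shape); so a refutation of V2202 would refute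
the Summit. [cite: KontsevichZagier2001, §1.2 Conjecture 1] -/
theorem stub_boxRigidity_var2202_of_statement (h : _root_.KontsevichZagierPeriods) :
    ∀ (m m' : ℕ) (N : IntegralRep m) (N' : IntegralRep m'), N.IsRational → N'.domain = {x | ∀ i, x i ∈ Set.Ioo (0:ℝ) 1} → N'.IsRational → N.value = N'.value → Equivalent N N' :=
  fun _ _ N N' hNr _ hN'r hv => _root_.KontsevichZagierPeriods_iff.1 h N N' hNr hN'r hv

/-! ## The variant against the crux, the kernel form, and its parent leaf -/

/-- **V2202 ⟺ `NormalFormPrinciple`**: the variant of the STUB is equivalent to the whole CRUX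
stmt-KontsevichZagierPeriods-3869 by name (`normalFormPrinciple_of_statement`, `closes`).
[cite: KontsevichZagier2001, §1.2 Conjecture 1] -/
theorem stub_boxRigidity_var2202_iff_normalFormPrinciple :
    (∀ (m m' : ℕ) (N : IntegralRep m) (N' : IntegralRep m'), N.IsRational → N'.domain = {x | ∀ i, x i ∈ Set.Ioo (0:ℝ) 1} → N'.IsRational → N.value = N'.value → Equivalent N N') ↔
    NormalFormPrinciple :=
  ⟨fun h => normalFormPrinciple_of_statement (statement_of_stub_boxRigidity_var2202 h),
    fun h => stub_boxRigidity_var2202_of_statement (closes h)⟩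

/-- **V2202 ⟺ `KZKernelConjecture`** (`ker eval = relations` for the tree's calculus).
[cite: KontsevichZagier2001, §1.2 Conjecture 1] -/
theorem stub_boxRigidity_var2202_iff_kzKernelConjecture :
    (∀ (m m' : ℕ) (N : IntegralRep m) (N' : IntegralRep m'), N.IsRational → N'.domain = {x | ∀ i, x i ∈ Set.Ioo (0:ℝ) 1} → N'.IsRational → N.value = N'.value → Equivalent N N') ↔
    KZKernelConjecture :=
  ⟨fun h => kzKernelConjecture_of_vanishing_var2202 (vanishing_of_stub_boxRigidity_var2202 h),
    fun h => stub_boxRigidity_var2202_of_statement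
      (_root_.KontsevichZagierPeriods_iff.2 (kzKernelConjecture_iff_isRational.1 h))⟩

/-- **Exact strength relative to the parent: `V2202 ⟺ BoxRigidity ∧ PiCancellation`.** Dropping the
hypothesis `N.domain = box` adds to the leaf exactly the line's other leaf (`leaves_of_statement`,
`statement_of_leaves`). [cite: KontsevichZagier2001, §1.2 Conjecture 1] -/
theorem stub_boxRigidity_var2202_iff_parent_and_piCancellation :
    (∀ (m m' : ℕ) (N : IntegralRep m) (N' : IntegralRep m'), N.IsRational → N'.domain = {x | ∀ i, x i ∈ Set.Ioo (0:ℝ) 1} → N'.IsRational → N.value = N'.value → Equivalent N N') ↔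
    ((∀ (m m' : ℕ) (N : IntegralRep m) (N' : IntegralRep m'),
      N.domain = {x | ∀ i, x i ∈ Set.Ioo (0:ℝ) 1} → N.IsRational →
      N'.domain = {x | ∀ i, x i ∈ Set.Ioo (0:ℝ) 1} → N'.IsRational →
      N.value = N'.value → Equivalent N N') ∧ PiCancellation) :=
  ⟨fun h => leaves_of_statement (statement_of_stub_boxRigidity_var2202 h),
    fun h => stub_boxRigidity_var2202_of_statement (statement_of_leaves h.1 h.2)⟩

/-- **V2202 ⇒ `KZ.PiLocalKernel`** (Ayoub's localised kernel conjecture for this calculus, through the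
parent leaf and `piLocalKernel_of_boxRigidity`). [cite: Ayoub2014, Def. 6 and Conj. 7] -/
theorem piLocalKernel_of_stub_boxRigidity_var2202
    (h : ∀ (m m' : ℕ) (N : IntegralRep m) (N' : IntegralRep m'), N.IsRational → N'.domain = {x | ∀ i, x i ∈ Set.Ioo (0:ℝ) 1} → N'.IsRational → N.value = N'.value → Equivalent N N') :
    PiLocalKernel :=
  piLocalKernel_of_boxRigidity (stub_boxRigidity_var2202_iff_parent_and_piCancellation.1 h).1

end Summit.KontsevichZagierPeriods.KontsevichZagierPeriods.Theorems
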